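import Mathlib
import Literature.Geometry.Symplectic.JHolomorphicMap
import Summits.SmoothPoincare4.SmoothPoincare4.Theorems.SullivanDualTameOrBrodyR4PencilDefs
import Summits.SmoothPoincare4.SmoothPoincare4.Theorems.SullivanDualTameOrBrodyR4StubAnchorOfPencil
import Summits.SmoothPoincare4.SmoothPoincare4.Theorems.SullivanDualTameOrBrodyR4HelperAnchorQuotientStructure
import Summits.SmoothPoincare4.SmoothPoincare4.Theorems.SullivanDualTameOrBrodyR4HelperFarHonestStructure
import Summits.SmoothPoincare4.SmoothPoincare4.Theorems.SullivanDualTameOrBrodyR4HelperPlanarNoCriticalPoint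

/-!
# Stub `stub_transversePencil` of crux `TameOrBrodyR4` (stmt-SmoothPoincare4-7826, line `Sketch`, skeleton v13): a member of the reversed frame is transverse to every slice of a complete pencil

Route `SullivanDual`, crux `Summit.SmoothPoincare4.SmoothPoincare4.Theses.SullivanDual.TameOrBrodyR4`.
This file proves the RESHAPED fourth deep stub of the line skeleton (v13), which replaces the
positivity-of-intersections input `HasTransverseMembers` (`A·B = 1`) at the only place where the
composition `pencilsOrBlowup₃_of_deep` uses it — after `stub_continuity` has delivered the COMPLETE
pencil `F` of the frame `(P, Q)`:

* `stub_transversePencil`: if `F` is a complete pencil of the frame `(P, Q)` (jointly `C^∞`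
  bijective evaluation map with bijective differential, slices are members, far members are the
  flat planes `{Q = b}`, `|b| ≥ 3R`) and `w` is a member of the reversed frame `(Q, P)`, then a
  tangent vector common to a slice `F b` and to `w` at a common point is zero.

Proof (Gromov's transversality read in the plane): let `β` be the `C^∞` inverse of the pencil chart
`Φ (b, ξ) = F b ξ` and `bm = fst ∘ β` its anchor map (`stub_anchorOfPencil`: submersion, kernel =
tangent plane of the member through the point, `J`-invariant, honest `bm = Q` where `|Q| ≥ 3R`).
The planar map `f := bm ∘ w : ℂ → ℂ` is `C^∞` and quasi-holomorphic for the `C^∞` field of complex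
structures `jt η = d bm ∘ J ∘ ∂_b Φ` (`helper_anchorQuotientStructure`), standard and holomorphic
near infinity with `f η - η → 0` (`helper_farHonestStructure`), hence has injective differential
everywhere (`helper_planarNoCriticalPoint`: conjugate Beltrami equation for `½(1 - i jt) ∂ₓ f`,
δ-regularised Carleman similarity principle, winding numbers). A common tangent vector
`d(F b)_ξ v = dw_η v'` gives `df_η v' = d bm (d(F b)_ξ v) = 0`, so `v' = 0`, so `d(F b)_ξ v = 0` and
`v = 0` because members are immersed.

References: M. Gromov, *Pseudo holomorphic curves in symplectic manifolds*, Invent. Math. 82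
(1985), §2.4.A; D. McDuff, D. Salamon, *J-holomorphic curves and symplectic topology* (2012),
§2.3 (Carleman similarity principle), §2.6; L. Bers, L. Nirenberg (1954); I. N. Vekua (1962).
-/

-- the registered namespace `Summit.SmoothPoincare4.SmoothPoincare4.…` repeats a component
set_option linter.dupNamespace false

noncomputable section

open scoped ContDiff Topology
open Filter Set Metric Literature.Geometry.Symplectic

namespace Summit.SmoothPoincare4.SmoothPoincare4.Cruxes.TameOrBrodyR4.Sketch

/-- Local notation for the model space `ℝ⁴ = EuclideanSpace ℝ (Fin 4)`. -/
local notation "E4" => EuclideanSpace ℝ (Fin 4)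

/-- **Stub (reshaped DEEP 2c) `stub_transversePencil`: a member of the reversed frame is
transverse to every slice of a complete pencil.** `F` is the complete pencil of the frame `(P, Q)`
delivered by `stub_continuity` (jointly `C^∞`, bijective, bijective differential, slices are
members, far members are the flat planes `{Q = b}`, `|b| ≥ 3R`); `w` is a member of the reversed
frame `(Q, P)`. Then a tangent vector common to `F b` at `ξ` and to `w` at `η` (at a common point)
is zero. -/
theorem stub_transversePencil (J : E4 → E4 →L[ℝ] E4) (R : ℝ) (P Q : E4 →L[ℝ] ℂ) (eP eQ : ℂ →L[ℝ] E4)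
    (hR : 0 < R) (hJs : ContDiff ℝ ∞ J) (hJ2 : ∀ x v, J x (J x v) = -v)
    (hPQ : IsCoordFrame P Q eP eQ)
    (hJP : ∀ x : E4, R ≤ ‖x‖ → ∀ v, P (J x v) = Complex.I * P v)
    (hJQ : ∀ x : E4, R ≤ ‖x‖ → ∀ v, Q (J x v) = Complex.I * Q v)
    (F : ℂ → ℂ → E4) (hF1 : ContDiff ℝ ∞ (fun p : ℂ × ℂ => F p.1 p.2))
    (hF2 : Function.Bijective (fun p : ℂ × ℂ => F p.1 p.2))
    (hF3 : ∀ p : ℂ × ℂ, Function.Bijective (fderiv ℝ (fun p : ℂ × ℂ => F p.1 p.2) p))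
    (hF4 : ∀ b, IsPencilMember J R P Q b (F b))
    (hF5 : ∀ b : ℂ, 3 * R ≤ ‖b‖ → ∀ ξ, Q (F b ξ) = b)
    (hF5' : ∀ x : E4, 3 * R ≤ ‖Q x‖ → ∃ ξ, F (Q x) ξ = x)
    (c : ℂ) (w : ℂ → E4) (hw : IsPencilMember J R Q P c w) :
    ∀ b ξ η : ℂ, F b ξ = w η → ∀ v v' : ℂ, fderiv ℝ (F b) ξ v = fderiv ℝ w η v' → v = 0 := by
  have _ := hJP -- the frame hypothesis on `P` is part of the registered signature, unused here
  -- the pencil chart, its smooth inverse `β` and the anchor map `fst ∘ β`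
  obtain ⟨β, hβ, hl, hr, -, hker, hkerJ, hhon, -⟩ :=
    stub_anchorOfPencil J (3 * R) Q F hF1 hF2 hF3 (fun b => (hF4 b).2.1) hF5 hF5'
  -- member data of `w` (reversed frame): smooth, `J`-holomorphic, `Q (w η) - η → 0`
  obtain ⟨hws, hwJ, -, -, -, hwn, -, -⟩ := hw
  have hQn : ∀ x : E4, ‖Q x‖ ≤ ‖x‖ := PencilDefs.norm_Q_le hPQ
  -- the planar map `f = fst ∘ β ∘ w` is quasi-holomorphic, standard near infinity, normalised
  obtain ⟨hfs, hjs, hjj, hstr, hchain⟩ :=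
    helper_anchorQuotientStructure J hJs hJ2 F hF1 β hβ hl hr hkerJ w hws hwJ
  obtain ⟨ρ₁, -, hfar_j, hfar_f, hnorm⟩ :=
    helper_farHonestStructure J R hR Q hQn hJQ F hF1 β hβ hl hr hhon w hws hwJ hwn
  -- hence its differential is injective everywhere
  have hinj := helper_planarNoCriticalPoint _ _ ρ₁ hfs hjs hjj hstr hfar_j hfar_f hnorm
  -- transversality
  intro b ξ η hx v v' hv
  have hβx : β (w η) = (b, ξ) := by rw [← hx]; exact hl (b, ξ)
  have h0 : fderiv ℝ (fun y => (β y).1) (w η) (fderiv ℝ (F b) ξ v) = 0 := by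
    refine (hker (w η) _).2 ⟨v, ?_⟩
    rw [hβx]
  have h1 : fderiv ℝ (fun η => (β (w η)).1) η v' = 0 := by rw [hchain, ← hv, h0]
  have hv' : v' = 0 := hinj η v' h1
  have h2 : fderiv ℝ (F b) ξ v = fderiv ℝ (F b) ξ 0 := by rw [hv, hv', map_zero, map_zero]
  exact (hF4 b).2.2.2.1 ξ h2

end Summit.SmoothPoincare4.SmoothPoincare4.Cruxes.TameOrBrodyR4.Sketch
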